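import Mathlib
import Summits.Ventures.FusionMHD.Models.RwmFRS1M4Solution
import Summits.Ventures.FusionMHD.Models.RwmFRS1Energy
import HarnessLib

/-!
# F3.r4 instance «RwmFRS1», companion mode `(4,1)`: the POSITIVE side — `δW_∞ > 0`, every admissible displacement has
# positive energy with or without a wall, and the thin-wall dispersion relation has only DECAYING roots (no RWM)

The `m = 4` companion of `RwmFRS1Energy.lean` (model-6 g6; lead #71-cand object «companion (4,1) no-wall positive»).
MODEL M_RWM as there (FRS1 screw pinch `TearingFRS1.Sigma.dyn` + vacuum + thin resistive wall, `R₀ = 5a` declared; W6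
verbatim: reduced-MHD data, not exactly force-balanced), CLASS C = the external helical mode `(m,n) = (4,1)` (`nq_a = 14/5 < m − 1`).
With the kernel marginal solution `M4.xi` (`5.6180734 < L₄ < 5.6180735`, `RwmFRS1M4Solution.lean`), the boundary form
`δŴ₄(L, Λ) = (9L − 51)/19649 + 9Λ/4900` (`RwmFRS1M4.lean`) and lit-3's `20/21 = m/(m+ζ_a) ≤ Λ_∞ < Λ_b` (ScrewPinchWallFactor §3, §8):
* `externalEnergy_xi` — (11.148) for `ξ₁`: `externalEnergy 4 k 1 Λ ξ₁ = δŴ₄(L₄, Λ)·ξ₁(1)²`;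
* `lambdaCrit_bounds` — `0.0121 < Λ_crit,4 < 0.0122` (far below `20/21`);
* **`dWinf_pos`** (`δW_∞ > 0`), **`dWb_pos`** (`δW_b > 0` for EVERY wall `b > a`);
* **`noWall_stable`**, **`idealWall_stable`** — via lit-4's `newcombExternalModes_iff`: EVERY admissible displacement has
  positive external `(4,1)` energy in M_RWM, without a wall and with a perfectly conducting wall at any `b > a`;
* **`no_rwm`** — for every wall `b > a`, every root of the printed thin-wall relation `γτ_w·δW_b = −δW_∞` with `τ_w > 0`
  has `γ < 0` («both `δW_∞` and `δW_b` must be positive for stability» [Freidberg2014 §11.5.6 p. 492] — they are).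
VALIDATED (not load-bearing): float `L₄ = 5.61807`, `Λ_crit,4 = 0.01212`, `δŴ₄(Λ_∞) = +1.81·10⁻³` (cert/model-6/f3r4_validate.json).
A statement about M_RWM's `(4,1)` mode; juxtaposed with the `(3,1)` row (same model: `δW_∞ < 0` there), never merged; nothing
about a device. [instance data]
-/

noncomputable section

open Set Filter Literature.Analysis.ODE Literature.MathematicalPhysics.MHD Literature.MathematicalPhysics.MHD.ScrewPinch
open scoped Topology

namespace Summit.Ventures.FusionMHD.Models

namespace RwmFRS1

namespace M4

/-- **(11.148) FOR THE `(4,1)` MARGINAL SOLUTION**: `externalEnergy 4 k 1 Λ ξ₁ = δŴ₄(L₄, Λ)·ξ₁(1)²`.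
[cite: Freidberg2014, §11.5.6 eq. (11.148)] -/
theorem externalEnergy_xi (Λ : ℝ) :
    P.externalEnergy 4 kk 1 Λ M4.xi = M4.boundaryForm (1 * deriv M4.xi 1 / M4.xi 1) Λ * M4.xi 1 ^ 2 := by
  obtain ⟨hBθ, hBz, hp, hBθ0⟩ := profile_regular (51 / 50)
  have hF : ∀ r ∈ Ioc (0 : ℝ) 1, P.kDotB 4 kk r ≠ 0 := fun r hr => M4.kDotB_ne_zero hr.1 (by nlinarith [hr.1, hr.2])
  have hODE : ∀ r ∈ Ioo (0 : ℝ) 1,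
      HasDerivAt (fun s => P.newcombF 4 kk s * deriv M4.xi s) (P.newcombG 4 kk r * M4.xi r) r :=
    fun r hr => M4.xi_newcomb ⟨hr.1, by linarith [hr.2]⟩
  have hE := Profile.fluidEnergy_eq_boundary_of_solution (P := P) (m := 4) (k := kk) one_pos
    (by norm_num : (1 : ℝ) < 51 / 50) (by norm_num) hBθ hBz hp hBθ0 hF M4.xi_contDiffOn hODE
  have hx : M4.xi 1 ≠ 0 := M4.xi_ne_zero 1 ⟨one_pos, le_rfl⟩
  unfold Profile.externalEnergy
  rw [hE, M4.boundaryForm]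
  unfold Profile.newcombF
  field_simp
  ring

/-- The NO-WALL reference energy of the `(4,1)` marginal solution. [cite: Freidberg2014, §11.5.6 eq. (11.149)] -/
def dWinf : ℝ := P.externalEnergy 4 kk 1 (Vacuum.wallFactorInf 4 kk 1) M4.xi

/-- The IDEAL-WALL reference energy of the `(4,1)` marginal solution, wall at `r = b`. [cite: Freidberg2014, §11.5.6 eq. (11.149)] -/
def dWb (b : ℝ) : ℝ := P.externalEnergy 4 kk 1 (Vacuum.wallFactor 4 kk 1 b) M4.xi

/-- `ξ₁(1)² > 0`. [instance data] -/
theorem xi_one_sq_pos : 0 < M4.xi 1 ^ 2 := by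
  have := M4.xi_pos one_pos le_rfl
  positivity

/-- **`0.0121 < Λ_crit,4 < 0.0122`** (from `5.6180734 < L₄ < 5.6180735`). [instance data] -/
theorem lambdaCrit_bounds : (121 / 10000 : ℝ) < M4.lambdaCrit (1 * deriv M4.xi 1 / M4.xi 1) ∧
    M4.lambdaCrit (1 * deriv M4.xi 1 / M4.xi 1) < (122 / 10000 : ℝ) := by
  obtain ⟨h1, h2⟩ := M4.L_bounds
  unfold M4.lambdaCrit
  constructor <;> linarith

/-- `20/21 ≤ Λ_∞(4, k, 1)` (lit-3's `m/(m + ζ_a) ≤ Λ_∞`). [cite: Freidberg2014, §11.5.6 eq. (11.150)] -/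
theorem wallFactorInf_ge : (20 / 21 : ℝ) ≤ Vacuum.wallFactorInf 4 kk 1 := by
  have hk : kk ≠ 0 := by rw [kk]; norm_num
  have h := Vacuum.div_le_wallFactorInf (m := 4) (by norm_num) hk one_pos
  rw [kk] at h ⊢
  norm_num at h ⊢
  exact h

/-- **`δW_∞ > 0`** for the `(4,1)` mode of MODEL M_RWM (`Λ_∞ ≥ 20/21 > Λ_crit,4`). [cite: Freidberg2014, §11.5.6 eq. (11.151)] -/
theorem dWinf_pos : 0 < M4.dWinf := by
  rw [M4.dWinf, externalEnergy_xi]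
  have hpos : 0 < M4.boundaryForm (1 * deriv M4.xi 1 / M4.xi 1) (Vacuum.wallFactorInf 4 kk 1) := by
    rw [M4.boundaryForm_pos_iff]
    linarith [lambdaCrit_bounds.2, wallFactorInf_ge]
  exact mul_pos hpos xi_one_sq_pos

/-- **`δW_b > 0` for EVERY conducting wall `b > a`** (`Λ_b > Λ_∞`). [cite: Freidberg2014, §11.5.6 eq. (11.150)] -/
theorem dWb_pos {b : ℝ} (hb : 1 < b) : 0 < M4.dWb b := by
  rw [M4.dWb, externalEnergy_xi]
  have hk : kk ≠ 0 := by rw [kk]; norm_num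
  have hlt := Vacuum.wallFactorInf_lt_wallFactor (m := 4) (by norm_num) hk one_pos hb
  have hpos : 0 < M4.boundaryForm (1 * deriv M4.xi 1 / M4.xi 1) (Vacuum.wallFactor 4 kk 1 b) := by
    rw [M4.boundaryForm_pos_iff]
    linarith [lambdaCrit_bounds.2, wallFactorInf_ge]
  exact mul_pos hpos xi_one_sq_pos

/-- Newcomb's external-mode test for the `(4,1)` mode of MODEL M_RWM (lit-4's `newcombExternalModes_iff` with the kernel `ξ₁`).
[cite: Freidberg2014, §11.5.3 eq. (11.118)] -/
theorem externalModes_iff (Λ : ℝ) :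
    (∀ ξ : ℝ → ℝ, IsAdmissible ξ → 0 < P.externalEnergy 4 kk 1 Λ ξ) ↔
      0 < M4.boundaryForm (1 * deriv M4.xi 1 / M4.xi 1) Λ * M4.xi 1 ^ 2 := by
  obtain ⟨hBθ, hBz, hp, hBθ0⟩ := profile_regular (51 / 50)
  have hF : ∀ r ∈ Ioc (0 : ℝ) 1, P.kDotB 4 kk r ≠ 0 := fun r hr => M4.kDotB_ne_zero hr.1 (by nlinarith [hr.1, hr.2])
  have hODE : ∀ r ∈ Ioo (0 : ℝ) 1,
      HasDerivAt (fun s => P.newcombF 4 kk s * deriv M4.xi s) (P.newcombG 4 kk r * M4.xi r) r :=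
    fun r hr => M4.xi_newcomb ⟨hr.1, by linarith [hr.2]⟩
  have h := Profile.newcombExternalModes_iff (P := P) (m := 4) (k := kk) one_pos (by norm_num : (1 : ℝ) < 51 / 50)
    (by norm_num) hBθ hBz hp hBθ0 hF M4.xi_contDiffOn hODE M4.xi_ne_zero Λ
  rw [M4.boundaryForm_mul] at h
  constructor
  · intro hall
    exact h.1 fun ξ hξ hne => hall ξ ⟨hξ, hne⟩
  · intro hpos ξ hξ
    exact h.2 hpos ξ hξ.1 hξ.2

/-- **NO WALL: every admissible displacement has positive `(4,1)` energy** in MODEL M_RWM (the no-wall-STABLE side for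
this mode; contrast `RwmFRS1.noWall_not_stable` for `(3,1)` in the same model). [cite: Freidberg2014, §11.5.6 eq. (11.151)] -/
theorem noWall_stable :
    ∀ ξ : ℝ → ℝ, IsAdmissible ξ → 0 < P.externalEnergy 4 kk 1 (Vacuum.wallFactorInf 4 kk 1) ξ := by
  have h := dWinf_pos
  rw [M4.dWinf, externalEnergy_xi] at h
  exact (externalModes_iff _).2 h

/-- **IDEAL WALL at any `b > a`: every admissible displacement has positive `(4,1)` energy.** [cite: Freidberg2014, §11.5.6 eq. (11.151)] -/
theorem idealWall_stable {b : ℝ} (hb : 1 < b) :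
    ∀ ξ : ℝ → ℝ, IsAdmissible ξ → 0 < P.externalEnergy 4 kk 1 (Vacuum.wallFactor 4 kk 1 b) ξ := by
  have h := dWb_pos hb
  rw [M4.dWb, externalEnergy_xi] at h
  exact (externalModes_iff _).2 h

/-- **NO RESISTIVE WALL MODE for `(4,1)`**: for every thin resistive wall at `b > a` every root `γ` of the printed relation
`γτ_w·δW_b = −δW_∞` with `τ_w > 0` is negative (decay), since `δW_∞ > 0` and `δW_b > 0` («both must be positive for
stability» — they are). [cite: Freidberg2014, §11.5.6 eq. (11.169)] -/
theorem no_rwm {b γ τw : ℝ} (hb : 1 < b) (hτ : 0 < τw)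
    (h : ResistiveWall.IsThinWallRate M4.dWinf (M4.dWb b) τw γ) : γ < 0 :=
  (h.decay_iff hτ (dWb_pos hb)).2 dWinf_pos

end M4

end RwmFRS1

end Summit.Ventures.FusionMHD.Models

end
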